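import Summits.Ventures.HSemireg.Pad4TowerCrossPhase

/-!
# Venture HSemireg — PAD-4 on 𝔅(μ₄): the ALPHABET-FREE X-PHASE kill of an O-factor next to a unit letter, μ₄ version
# (the one μ₄-specific step of THEOREM X∞'s charge induction, on `Pad4TowerCrossPhase`'s `XPhaseDeadMu4`)

HONEST FRAMING. Lean index of the computation cell `pub-hsemireg` (S4-PUSH, H2 door PAD-4); seat `hodge-semireg-assembly-p1`. All of this
seat's other files are on the (F1ℝ) slice (phases `±1`). The memo of record for THEOREM X∞ (bc5-plan g4 v4.1 df3e4f41db3c2fcf §6) says: «the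
(F1ℝ) slice is a faithful restriction because every step of §1–§4 stays inside the phases already present except the ONE sibling in §2 (N_c),
which in (F1ℝ) is the swap». THIS FILE types that one step ON 𝔅(μ₄) ITSELF, with typer-2's μ₄ predicate `XPhaseDeadMu4`
(`Pad4TowerCrossPhase`, LEMMA X-PHASE §22 text of record v2.3∕v2.5, ×2 s4-ref g72): **an `N`-cell with an O-factor `f`, the unit letter
`ℓ_u` on `σ`, its full cancellation `Z[σ ↦ O] ∈ E₊` and ONE phase sibling `Z[σ ↦ ℓ_w] ∈ E₋` (`w ≠ u`, any of the three) satisfies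
`XPhaseDeadMu4 C Z σ u f`, provided the `P`-letters lie in the closed future cone of the apex `O`** (`Effective`; automatic in every census
alphabet — O, rays `c·ℓ`, towers `2I + c·ℓ` — and exactly the reading «apex point = cone vertex» of g72's O1 ∕ the bare-apex probe of
`Pad4TowerCrossPhase`). This is the μ₄ twin of `Pad4TowerUniverseU6X.xPhaseDead_of_unit_letter` and the d = 1 case of `XClean`'s forbidden
configuration (`Pad4TowerXInfA`); `xPhaseDeadMu4_of_ray` is the GENERAL-DEPTH μ₄ case (ray `c·ℓ_u`, cancellation present, no intermediate
own-ray and no `w`-companion `P` of charge `1 ≤ c′ < c`, sibling `c·ℓ_w` present) = the μ₄ form of `XClean`'s configuration (memo §6 (S-ii);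
LEG A cce93bb8701bf60e (0.4) «§22 REMARK (2) at all d»). A μ₄ RULE D is NOT typed (none exists in the tree), so the μ₄ THEOREM X∞ itself is
not assembled here. Pencil meaning of `XPhaseDeadMu4` (NOT in Lean): `Z` violates (E1). Nothing here says HC ∕ HC_CM ∕ HC_AV ∕ W₆ ∕ HC_Kum4Type holds or fails; no
`instance`, no notation, no named fact, 0 `sorry`; axioms standard.

SOURCES (sha16): `Pad4TowerCrossPhase.lean` 8f09792281b0723a (typer hodge-lit-semireg-typer-2 g0; `XPhaseDeadMu4`, `UPartner`, `MPinned`,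
`Sibling`, `NoCompanion`, `StrongHb`, `ConeAbove`, `step`, `ray`); PAD4-BALANCED §22; s4-ref g72 9150caba90bff308; BC5-PLAN-g4-MEMO v4.1 §2, §6.
-/

namespace Summit.Ventures.HSemireg.Pad4Tower

open Finset

/-- the unit step is `ray O k 1`. -/
theorem ray_zero_one (k : Fin 4) : ray (0, 0, 0) k 1 = step k := by
  fin_cases k <;> rfl

/-- the first coordinate of a unit step is `1`. -/
theorem step_fst (k : Fin 4) : (step k).1 = 1 := rfl

/-- a point in the closed future cone of `O` that lies causally BELOW `O` is `O`. -/
theorem eq_zero_of_effective_of_le {x : BPoint} (hx : Effective x) (hle : Effective (bsub (0, 0, 0) x)) : x = (0, 0, 0) := by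
  obtain ⟨a, b, c⟩ := x
  simp only [Effective] at hx hle
  obtain ⟨ha, hbc⟩ := hx
  obtain ⟨ha', hbc'⟩ := hle
  have ha0 : a = 0 := by omega
  subst ha0
  have hb : b ^ 2 = 0 := by nlinarith [sq_nonneg b, sq_nonneg c]
  have hc : c ^ 2 = 0 := by nlinarith [sq_nonneg b, sq_nonneg c]
  rw [pow_eq_zero_iff two_ne_zero] at hb hc
  subst hb; subst hc; rfl

/-- **the μ₄ alphabet-free X-PHASE kill.** `Z` has the O-factor `f`, the unit letter `ℓ_{i^k}` on `σ ≠ f`; its full cancellation is a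
`P`-cell and one phase sibling `Z[σ ↦ ℓ_{i^{k′}}]`, `k′ ≠ k`, is an `N`-cell; every `P`-letter is in the future cone of `O`. Then
`XPhaseDeadMu4 C Z σ k f`: the only `u`-partner is the cancellation (a partner's `σ`-letter lies below `ℓ_u` and in the cone, so it is
`O`); (H-e′) is the cone hypothesis; the sibling is a `w`-server at height 1, so (H-d) is vacuous; (H-b) strong: a `P ≤ n` has its
`f`-letter causally below `n_f = Z_f = O` and in the cone, hence `= O = Z_f`. -/
theorem xPhaseDeadMu4_of_unit_letter (C : MConfig) (hcone : ∀ P ∈ C.upper, ∀ g, Effective (P g)) {Z : MCell} {σ f : Fin 4}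
    (hσf : σ ≠ f) (hO : Z f = (0, 0, 0)) {k : Fin 4} (hZσ : Z σ = step k) (hq : Function.update Z σ (0, 0, 0) ∈ C.upper)
    {k' : Fin 4} (hk' : k' ≠ k) (hn : Function.update Z σ (step k') ∈ C.lower) : XPhaseDeadMu4 C Z σ k f := by
  have hq1 : UPartner Z (Function.update Z σ (0, 0, 0)) σ k := by
    refine ⟨fun g hg => Function.update_of_ne hg _ _, ?_, ?_⟩
    · rw [Function.update_self, hZσ, step_fst]; decide
    · rw [Function.update_self, hZσ, step_fst]; exact (ray_zero_one k).symm
  -- every u-partner is the full cancellation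
  have huniq : ∀ q ∈ C.upper, UPartner Z q σ k → q = Function.update Z σ (0, 0, 0) := by
    rintro q hqu ⟨hag, hlt, hray⟩
    have h0 : (q σ).1 = 0 := by
      have := (hcone q hqu σ).1; rw [hZσ, step_fst] at hlt; omega
    have hqσ : q σ = (0, 0, 0) := by
      rw [hZσ] at hray
      rw [step_fst, h0] at hray
      have h1 := congrArg (fun p : BPoint => p.2.1) hray
      have h2 := congrArg (fun p : BPoint => p.2.2) hray
      have e1 : (q σ).2.1 = 0 := by fin_cases k <;> simp [step] at h1 <;> omega
      have e2 : (q σ).2.2 = 0 := by fin_cases k <;> simp [step] at h2 <;> omega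
      exact Prod.ext h0 (Prod.ext e1 e2)
    funext g
    by_cases hg : g = σ
    · subst hg; rw [Function.update_self]; exact hqσ
    · rw [Function.update_of_ne hg]; exact hag g hg
  refine ⟨hσf, ⟨_, hq, hq1⟩, fun q hqu hqp => ?_⟩
  rw [huniq q hqu hqp]
  refine ⟨fun P hP _ => by simpa [Effective, bsub] using hcone P hP σ, Function.update Z σ (step k'), hn, k', hk', ?_, ?_, ?_⟩
  · refine ⟨fun g hg => by rw [Function.update_of_ne hg, Function.update_of_ne hg], ?_, ?_⟩
    · rw [Function.update_self, Function.update_self, step_fst]; decide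
    · rw [Function.update_self, Function.update_self, step_fst]; exact (ray_zero_one k').symm
  · intro P _ _ h1 h2
    rw [Function.update_self] at h1; rw [Function.update_self, step_fst] at h2
    exact absurd h2 (by omega)
  · intro P hP hle
    have hf := hle f
    rw [Function.update_of_ne (Ne.symm hσf), hO] at hf
    rw [hO]
    exact eq_zero_of_effective_of_le (hcone P hP f) hf

/-- components of the charged letter `lpt c k = c·ℓ_{i^k}`. -/
theorem lpt_eq (c : ℤ) (k : Fin 4) : lpt c k = (c, c * ![1, 0, -1, 0] k, c * ![0, -1, 0, 1] k) := by
  simp [lpt, ray]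

/-- a point `x` with `lpt c k = ray x k d` is the own-ray point `lpt (c - d) k`. -/
theorem eq_lpt_of_ray {x : BPoint} {c d : ℤ} {k : Fin 4} (h : lpt c k = ray x k d) : x = lpt (c - d) k := by
  obtain ⟨a, b₁, b₂⟩ := x
  rw [lpt_eq] at h
  have h0 := congrArg (fun p : BPoint => p.1) h
  have h1 := congrArg (fun p : BPoint => p.2.1) h
  have h2 := congrArg (fun p : BPoint => p.2.2) h
  simp only at h0 h1 h2
  rw [lpt_eq]
  refine Prod.ext ?_ (Prod.ext ?_ ?_) <;> simp only <;> fin_cases k <;> simp at h1 h2 ⊢ <;> omega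

/-- **the μ₄ X-PHASE kill at GENERAL DEPTH — the μ₄ form of `XClean`'s forbidden configuration** (bc5-plan g4 memo §6 (S-ii); §22 REMARK
(2) at general `d`, LEG A cce93bb8701bf60e (0.4)): `Z` has the O-factor `f` and the pure ray `c·ℓ_u` (`c ≥ 1`, `u = i^k`) on `σ ≠ f`; its
full cancellation `Z[σ ↦ O]` is a `P`-cell; NO intermediate own-ray `P`-cell `Z[σ ↦ c′ℓ_u]` and no `w`-companion `Z[σ ↦ c′ℓ_w]`
(`1 ≤ c′ < c`) is present; the sibling `Z[σ ↦ c·ℓ_w]` (`w = i^{k′} ≠ u`) is an `N`-cell; `P`-letters lie in the future cone of `O`. Then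
`XPhaseDeadMu4 C Z σ k f` (unique `u`-partner = the cancellation — (x1); sibling = (H-c) with `e = c` — (x2); no companion — (H-d)∕(x3);
(H-e′) = cone; (H-b) strong at the O-factor). -/
theorem xPhaseDeadMu4_of_ray (C : MConfig) (hcone : ∀ P ∈ C.upper, ∀ g, Effective (P g)) {Z : MCell} {σ f : Fin 4} (hσf : σ ≠ f)
    (hO : Z f = (0, 0, 0)) {k : Fin 4} {c : ℤ} (hc : 1 ≤ c) (hZσ : Z σ = lpt c k) (hq : Function.update Z σ (0, 0, 0) ∈ C.upper)
    {k' : Fin 4} (hk' : k' ≠ k)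
    (hmid : ∀ c', 1 ≤ c' → c' < c → Function.update Z σ (lpt c' k) ∉ C.upper ∧ Function.update Z σ (lpt c' k') ∉ C.upper)
    (hn : Function.update Z σ (lpt c k') ∈ C.lower) : XPhaseDeadMu4 C Z σ k f := by
  have hc1 : (lpt c k).1 = c := by rw [lpt_eq]
  have hq1 : UPartner Z (Function.update Z σ (0, 0, 0)) σ k := by
    refine ⟨fun g hg => Function.update_of_ne hg _ _, ?_, ?_⟩
    · rw [Function.update_self, hZσ, hc1]; simp only; omega
    · rw [Function.update_self, hZσ, hc1]; simp [lpt]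
  have huniq : ∀ q ∈ C.upper, UPartner Z q σ k → q = Function.update Z σ (0, 0, 0) := by
    rintro q hqu ⟨hag, hlt, hray⟩
    rw [hZσ, hc1] at hray hlt
    have hx := eq_lpt_of_ray hray
    have ha0 : 0 ≤ (q σ).1 := (hcone q hqu σ).1
    set a := (q σ).1 with ha
    have hca : c - (c - a) = a := by omega
    rw [hca] at hx
    have hqfun : q = Function.update Z σ (lpt a k) := by
      funext g
      by_cases hg : g = σ
      · subst hg; rw [Function.update_self]; exact hx
      · rw [Function.update_of_ne hg]; exact hag g hg
    rcases (show a = 0 ∨ 1 ≤ a by omega) with h0 | h1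
    · rw [hqfun, h0]; simp [lpt, ray]
    · exact absurd (hqfun ▸ hqu) (hmid _ h1 hlt).1
  refine ⟨hσf, ⟨_, hq, hq1⟩, fun q hqu hqp => ?_⟩
  rw [huniq q hqu hqp]
  refine ⟨fun P hP _ => by simpa [Effective, bsub] using hcone P hP σ, Function.update Z σ (lpt c k'), hn, k', hk', ?_, ?_, ?_⟩
  · refine ⟨fun g hg => by rw [Function.update_of_ne hg, Function.update_of_ne hg], ?_, ?_⟩
    · rw [Function.update_self, Function.update_self, lpt_eq]; simp only; omega
    · rw [Function.update_self, Function.update_self, lpt_eq]; simp [ray]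
  · intro P hP hagP h1 h2 hP'
    rw [Function.update_self] at h1 hP'
    rw [Function.update_self, lpt_eq] at h2
    simp only at h1 h2
    have hPfun : P = Function.update Z σ (lpt (P σ).1 k') := by
      funext g
      by_cases hg : g = σ
      · subst hg; rw [Function.update_self, hP']; simp [lpt]
      · rw [Function.update_of_ne hg, hagP g hg, Function.update_of_ne hg]
    exact (hmid _ (by omega) h2).2 (hPfun ▸ hP)
  · intro P hP hle
    have hf := hle f
    rw [Function.update_of_ne (Ne.symm hσf), hO] at hf
    rw [hO]
    exact eq_zero_of_effective_of_le (hcone P hP f) hf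

/-! ## The cone hypothesis is automatic for the census letters -/

/-- a charged letter `c·ℓ_u` (`c ≥ 0`) lies in the closed future cone of `O`. -/
theorem effective_lpt {c : ℤ} (hc : 0 ≤ c) (k : Fin 4) : Effective (lpt c k) := by
  fin_cases k <;> simp [lpt, ray, Effective] <;> nlinarith

/-- a tower `2I + c·ℓ_u` (`c ≥ 0`) lies in the closed future cone of `O`. -/
theorem effective_tower {c : ℤ} (hc : 0 ≤ c) (k : Fin 4) : Effective (ray (2, 0, 0) k c) := by
  fin_cases k <;> refine ⟨by simp; omega, ?_⟩ <;> simp <;> nlinarith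

/-- hence `hcone` of the kills above holds for every configuration whose `P`-letters are `O`, rays `c·ℓ_u` or towers `2I + c·ℓ_u`
(the alphabet `𝒰` of THEOREM X∞ and every census universe U5…U8, U(D_T1), D_T2). -/
theorem cone_of_letters (C : MConfig)
    (hU : ∀ P ∈ C.upper, ∀ g, P g = (0, 0, 0) ∨ (∃ c k, 0 ≤ c ∧ P g = lpt c k) ∨ (∃ c k, 0 ≤ c ∧ P g = ray (2, 0, 0) k c)) :
    ∀ P ∈ C.upper, ∀ g, Effective (P g) := by
  intro P hP g
  rcases hU P hP g with h | ⟨c, k, hc, h⟩ | ⟨c, k, hc, h⟩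
  · rw [h]; decide
  · rw [h]; exact effective_lpt hc k
  · rw [h]; exact effective_tower hc k

end Summit.Ventures.HSemireg.Pad4Tower
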